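import Literature.MathematicalPhysics.QuantumFieldTheory.Balaban1983to89.Beta.Composition

/-!
# `Balaban1983to89.Beta.Envelope` — BETA sub-cell, row an1 (b2b-balaban-beta-an1): the LINEARISED MINIMISER, the VALUE
FORM and the CONSTRAINED PROPAGATOR of a constrained quadratic variational problem, with the EXACT first- and second-order
resolvent ("envelope") identities — kernel-checked finite-dimensional algebra

HONEST FRAMING (cell file `HOME/BETA-SPEC.md`, verbatim): discharging `BetaPertH` makes Bałaban's UV stability
UNCONDITIONAL — a real constructive-QFT result; it is NOT the continuum limit and NOT the Clay problem.  THIS MODULE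
DISCHARGES NOTHING of the series and asserts NOTHING about Bałaban's β-functions or his concrete lattice operators: it is
the linear algebra behind ONE bookkeeping point of the cell file `HOME/BETA/AN1.md` (Table T, row T4; §5.2): in the
one-step quadratic form `⟨B′, Δ^{(k)}(U) B′⟩ = ⟨H₁(U)B′, Δ₁(U) H₁(U)B′⟩` the background dependence of the minimiser map
`H₁(U)` enters the VALUE form only at SECOND order in the variation of `Δ₁(U)` — the first-order variation is the
variation of `Δ₁` sandwiched between the UNVARIED minimisers — and the second-order correction is governed by the
constrained propagator.  Value = kernel identity, NOT summit progress.

Printed anchors (quoted from the page renders; nothing else of the papers is used).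
[Balaban1985BackgroundPropagators] (CMP 99 (1985) 389), p. 417: «we define H(U)B, or simply HB, as a minimal
configuration of the functional  A → ½⟨A, Δ(U)A⟩,  (3.109)  on a set of configurations A defined on Ω₀, with values in
g, satisfying  L^jηQ_j(U)A = B on Λ_j, j = 0, 1, …, k,  R(U)D*_U A = 0.  (3.110)»; «The variational problem (3.109),
(3.110) has a unique solution. Indeed, the functional (3.109) is equal to  A → ½⟨A, (Δ + DRD* + Q*aQ)A⟩ − ½⟨B, aB⟩ =
½⟨A, Δ_a A⟩ − ½⟨B, aB⟩  (3.111)  on the hyperplane (3.110), hence the existence of a unique minimum on this hyperplane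
follows from positive definiteness of the operator Δ_a. This minimum is denoted by HB. It define a linear operator H.»;
p. 421: «H₁B = G₁Q*(QG₁Q*)⁻¹B.  (3.129)».  [Balaban1987RG1] (CMP 109 (1987) 249), (1.5) p. 261, first term:
«⟨B, Δ^{(j)}(U_k)B⟩ = ⟨H_{1,j}(U_k)B, Δ₁(U_k)H_{1,j}(U_k)B⟩ − …».

Finite-dimensional dictionary (this file; a MODEL, not a transcription).  `K : Matrix ν ν 𝕜` an invertible quadratic
form (the rôle of `Δ_a`, resp. `G₁⁻¹`), `Q : Matrix μ ν 𝕜` the linear constraint map with invertible block propagator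
`P := blockProp K Q = Q K⁻¹ Qᵀ` (`Beta.Composition`).  Then
* `minMap K Q := K⁻¹ Qᵀ P⁻¹` is the minimiser map `H` of (3.129) (`constraint_mul_minMap : Q H = 1`, the Lagrange
  condition `mul_minMap : K H = Qᵀ P⁻¹`, uniqueness `eq_minMap_of_stationary`, minimality `quad_eq_quad_minMap_add` /
  `quad_minMap_le`);
* the VALUE form is `Hᵀ K H = P⁻¹` (`transpose_minMap_mul_mul_minMap`; (1.5)'s `Δ^{(j)} = H₁ᵀ Δ₁ H₁` pattern);
* `constrProp K Q := K⁻¹ − H Q K⁻¹` is the constrained propagator `G` (`Q G = 0`, `G Qᵀ = 0`, `K G = 1 − Qᵀ Hᴸ`);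
* ENVELOPE IDENTITIES, exact for any two invertible forms `K₀, K₁` with the same `Q`:
  `P₁⁻¹ − P₀⁻¹ = H₀ᴸ (K₁ − K₀) H₁` (`value_sub_value`), `H₁ − H₀ = −G₀ (K₁ − K₀) H₁` (`minMap_sub_minMap`), hence
  `P₁⁻¹ − P₀⁻¹ = H₀ᴸ (K₁ − K₀) H₀ − H₀ᴸ (K₁ − K₀) G₀ (K₁ − K₀) H₁` (`value_sub_value₂`): to first order in `K₁ − K₀` the
  minimisers may be frozen, and the second-order term is the familiar `−Hᵀ E G E H`.
Here `Hᴸ := P⁻¹ Q K⁻¹` (`minMapL`), which equals `Hᵀ` for symmetric `K` (`minMapL_eq_transpose`).  Everything about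
Bałaban's actual operators (which `K`, `Q`; gauge conditions; k-uniform bounds; backgrounds) is OUTSIDE this file.
No `def … : Prop` is introduced (D-0026).  Cell audit ids: GAPS C-an1-5 (kernel certificate of this file).

v1.1 (append-only; every v1 declaration unchanged): §5 THE BORDERED INVERSE — the blocks of `[[K, Qᵀ],[Q, 0]]⁻¹`
(`Beta.Composition.kkt`) are exactly `[[G, H],[Hᴸ, −P⁻¹]]` (`kkt_mul_blocks`, `blocks_mul_kkt`, `kkt_inv`): the blocks
called `Γ, Ξ, Σ` of `M_k(1)⁻¹` in `HOME/BETA/AN1.md` (MF′) are the constrained propagator, the minimiser map and minus the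
inverse block propagator — not new objects (cell audit: answer to GAPS G-adv2-19 (b), recorded as C-an1-6).

v1.2 (append-only): §6 TRACE / PROJECTION IDENTITIES — `K G` is the projection onto the fluctuation directions along
`range Qᵀ`: `(K G)² = K G` (`mul_constrProp_idem`), `G K G = G` (`constrProp_mul_mul_constrProp`), and
`trace (K G) = card ν − card μ` (`trace_mul_constrProp`) = the number of fluctuation degrees of freedom; the finite-dimensional
skeleton of the exact «sum of plaquette fluctuation strengths = rank» identity observed numerically by the cell's U(1) engine
(HOME/b2b-balaban-beta-num NUM-C (2.6)); a MODEL statement, nothing about Bałaban's operators is asserted.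
-/

noncomputable section

namespace Literature.MathematicalPhysics.QuantumFieldTheory.Balaban1983to89.Beta.Envelope

open Literature.MathematicalPhysics.QuantumFieldTheory.Balaban1983to89.Beta.Composition (blockProp)
open scoped Matrix

section Algebra

variable {𝕜 : Type*} [Field 𝕜]
variable {ν μ : Type*} [Fintype ν] [Fintype μ] [DecidableEq ν] [DecidableEq μ]

/-- The minimiser map `H = K⁻¹ Qᵀ (Q K⁻¹ Qᵀ)⁻¹` of the constrained problem `min ½⟨A, K A⟩ s.t. Q A = B`
([Balaban1985BackgroundPropagators] (3.129) pattern). [folklore] -/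
def minMap (K : Matrix ν ν 𝕜) (Q : Matrix μ ν 𝕜) : Matrix ν μ 𝕜 :=
  K⁻¹ * Qᵀ * (blockProp K Q)⁻¹

/-- The left companion `Hᴸ = (Q K⁻¹ Qᵀ)⁻¹ Q K⁻¹` of the minimiser map (equal to `Hᵀ` for symmetric `K`). [folklore] -/
def minMapL (K : Matrix ν ν 𝕜) (Q : Matrix μ ν 𝕜) : Matrix μ ν 𝕜 :=
  (blockProp K Q)⁻¹ * Q * K⁻¹

/-- The constrained propagator `G = K⁻¹ − K⁻¹ Qᵀ (Q K⁻¹ Qᵀ)⁻¹ Q K⁻¹ = K⁻¹ − H Q K⁻¹`. [folklore] -/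
def constrProp (K : Matrix ν ν 𝕜) (Q : Matrix μ ν 𝕜) : Matrix ν ν 𝕜 :=
  K⁻¹ - minMap K Q * Q * K⁻¹

omit [Fintype μ] [DecidableEq μ] in
/-- Unfolding of `Beta.Composition.blockProp`: `P = Q K⁻¹ Qᵀ`. [folklore] -/
theorem blockProp_eq (K : Matrix ν ν 𝕜) (Q : Matrix μ ν 𝕜) : blockProp K Q = Q * K⁻¹ * Qᵀ := rfl

/-! ## §1. The minimiser map: constraint, Lagrange condition, value form -/

/-- `Q H = 1`: the minimiser satisfies the constraint (for `P = Q K⁻¹ Qᵀ` invertible). [folklore] -/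
theorem constraint_mul_minMap (K : Matrix ν ν 𝕜) (Q : Matrix μ ν 𝕜) (hP : IsUnit (blockProp K Q).det) :
    Q * minMap K Q = 1 := by
  have h : Q * minMap K Q = blockProp K Q * (blockProp K Q)⁻¹ := by
    simp only [minMap, blockProp_eq, Matrix.mul_assoc]
  rw [h, Matrix.mul_nonsing_inv _ hP]

/-- `Hᴸ Qᵀ = 1`. [folklore] -/
theorem minMapL_mul_transpose (K : Matrix ν ν 𝕜) (Q : Matrix μ ν 𝕜) (hP : IsUnit (blockProp K Q).det) :
    minMapL K Q * Qᵀ = 1 := by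
  have h : minMapL K Q * Qᵀ = (blockProp K Q)⁻¹ * blockProp K Q := by
    simp only [minMapL, blockProp_eq, Matrix.mul_assoc]
  rw [h, Matrix.nonsing_inv_mul _ hP]

/-- Lagrange (stationarity) condition: `K H = Qᵀ P⁻¹`, i.e. `K (H B)` lies in the range of `Qᵀ`. [folklore] -/
theorem mul_minMap (K : Matrix ν ν 𝕜) (Q : Matrix μ ν 𝕜) (hK : IsUnit K.det) :
    K * minMap K Q = Qᵀ * (blockProp K Q)⁻¹ := by
  simp only [minMap, Matrix.mul_assoc]
  rw [Matrix.mul_nonsing_inv_cancel_left K _ hK]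

/-- `Hᴸ K = P⁻¹ Q`. [folklore] -/
theorem minMapL_mul (K : Matrix ν ν 𝕜) (Q : Matrix μ ν 𝕜) (hK : IsUnit K.det) :
    minMapL K Q * K = (blockProp K Q)⁻¹ * Q := by
  simp only [minMapL]
  rw [Matrix.nonsing_inv_mul_cancel_right K _ hK]

/-- VALUE FORM: `Hᴸ K H = P⁻¹` — the constrained minimum value of `½⟨A, K A⟩` on `{Q A = B}` is `½⟨B, P⁻¹ B⟩`
([Balaban1987RG1] (1.5): `Δ^{(j)} = H₁ᵀ Δ₁ H₁`). [folklore] -/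
theorem minMapL_mul_mul_minMap (K : Matrix ν ν 𝕜) (Q : Matrix μ ν 𝕜) (hK : IsUnit K.det)
    (hP : IsUnit (blockProp K Q).det) : minMapL K Q * K * minMap K Q = (blockProp K Q)⁻¹ := by
  rw [minMapL_mul K Q hK, Matrix.mul_assoc, constraint_mul_minMap K Q hP, Matrix.mul_one]

/-- For symmetric `K`, `Hᴸ = Hᵀ`. [folklore] -/
theorem minMapL_eq_transpose (K : Matrix ν ν 𝕜) (Q : Matrix μ ν 𝕜) (hKs : Kᵀ = K) :
    minMapL K Q = (minMap K Q)ᵀ := by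
  simp only [minMapL, minMap, blockProp_eq, Matrix.transpose_mul, Matrix.transpose_transpose,
    Matrix.transpose_nonsing_inv, hKs, Matrix.mul_assoc]

/-- VALUE FORM, symmetric case: `Hᵀ K H = (Q K⁻¹ Qᵀ)⁻¹`. [folklore] -/
theorem transpose_minMap_mul_mul_minMap (K : Matrix ν ν 𝕜) (Q : Matrix μ ν 𝕜) (hKs : Kᵀ = K)
    (hK : IsUnit K.det) (hP : IsUnit (blockProp K Q).det) :
    (minMap K Q)ᵀ * K * minMap K Q = (blockProp K Q)⁻¹ := by
  rw [← minMapL_eq_transpose K Q hKs]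
  exact minMapL_mul_mul_minMap K Q hK hP

/-- UNIQUENESS of the stationary point: a configuration satisfying the constraint `Q A = B` and the Lagrange condition
`K A = Qᵀ λ` is `H B` ([Balaban1985BackgroundPropagators] p. 417 «has a unique solution», finite-dimensional
skeleton). [folklore] -/
theorem eq_minMap_of_stationary (K : Matrix ν ν 𝕜) (Q : Matrix μ ν 𝕜) (hK : IsUnit K.det)
    (hP : IsUnit (blockProp K Q).det) (A : ν → 𝕜) (B : μ → 𝕜) (lam : μ → 𝕜) (hA : Q *ᵥ A = B)
    (hstat : K *ᵥ A = Qᵀ *ᵥ lam) : A = minMap K Q *ᵥ B := by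
  have hA' : A = K⁻¹ *ᵥ (Qᵀ *ᵥ lam) := by
    rw [← hstat, Matrix.mulVec_mulVec, Matrix.nonsing_inv_mul K hK, Matrix.one_mulVec]
  have hB : B = blockProp K Q *ᵥ lam := by
    rw [← hA, hA', Matrix.mulVec_mulVec, Matrix.mulVec_mulVec, blockProp_eq]
  have hlam : lam = (blockProp K Q)⁻¹ *ᵥ B := by
    rw [hB, Matrix.mulVec_mulVec, Matrix.nonsing_inv_mul _ hP, Matrix.one_mulVec]
  rw [hA', hlam, minMap, Matrix.mulVec_mulVec, Matrix.mulVec_mulVec]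

/-- The cross term vanishes: `⟨A − H B, K (H B)⟩ = 0` for every `A` with `Q A = B`. [folklore] -/
theorem sub_minMap_dotProduct_mulVec (K : Matrix ν ν 𝕜) (Q : Matrix μ ν 𝕜) (hK : IsUnit K.det)
    (hP : IsUnit (blockProp K Q).det) (A : ν → 𝕜) (B : μ → 𝕜) (hA : Q *ᵥ A = B) :
    (A - minMap K Q *ᵥ B) ⬝ᵥ (K *ᵥ (minMap K Q *ᵥ B)) = 0 := by
  have h1 : K *ᵥ (minMap K Q *ᵥ B) = Qᵀ *ᵥ ((blockProp K Q)⁻¹ *ᵥ B) := by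
    rw [Matrix.mulVec_mulVec, mul_minMap K Q hK, ← Matrix.mulVec_mulVec]
  have h2 : Q *ᵥ (A - minMap K Q *ᵥ B) = 0 := by
    rw [Matrix.mulVec_sub, Matrix.mulVec_mulVec, constraint_mul_minMap K Q hP, Matrix.one_mulVec, hA, sub_self]
  rw [h1, Matrix.dotProduct_mulVec, Matrix.vecMul_transpose, h2]
  simp

omit [DecidableEq ν] in
/-- Symmetry of the bilinear form of a symmetric matrix. [folklore] -/
theorem dotProduct_mulVec_comm (K : Matrix ν ν 𝕜) (hKs : Kᵀ = K) (x y : ν → 𝕜) :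
    x ⬝ᵥ (K *ᵥ y) = y ⬝ᵥ (K *ᵥ x) := by
  rw [Matrix.dotProduct_mulVec, dotProduct_comm, ← Matrix.mulVec_transpose, hKs]

/-- PYTHAGORAS for the constrained problem ([Balaban1985BackgroundPropagators] (3.109)–(3.111), finite-dimensional
skeleton): for symmetric invertible `K` and every `A` with `Q A = B`,
`⟨A, K A⟩ = ⟨H B, K (H B)⟩ + ⟨A − H B, K (A − H B)⟩`. [folklore] -/
theorem quad_eq_quad_minMap_add (K : Matrix ν ν 𝕜) (Q : Matrix μ ν 𝕜) (hKs : Kᵀ = K) (hK : IsUnit K.det)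
    (hP : IsUnit (blockProp K Q).det) (A : ν → 𝕜) (B : μ → 𝕜) (hA : Q *ᵥ A = B) :
    A ⬝ᵥ (K *ᵥ A) = (minMap K Q *ᵥ B) ⬝ᵥ (K *ᵥ (minMap K Q *ᵥ B)) +
      (A - minMap K Q *ᵥ B) ⬝ᵥ (K *ᵥ (A - minMap K Q *ᵥ B)) := by
  set h := minMap K Q *ᵥ B with hh
  have c1 : (A - h) ⬝ᵥ (K *ᵥ h) = 0 := sub_minMap_dotProduct_mulVec K Q hK hP A B hA
  have c2 : h ⬝ᵥ (K *ᵥ (A - h)) = 0 := by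
    rw [dotProduct_mulVec_comm K hKs]; exact c1
  have e1 : (A - h) ⬝ᵥ (K *ᵥ (A - h)) = A ⬝ᵥ (K *ᵥ A) - h ⬝ᵥ (K *ᵥ A) := by
    rw [Matrix.mulVec_sub, dotProduct_sub, c1, sub_zero, sub_dotProduct]
  have e2 : h ⬝ᵥ (K *ᵥ A) = h ⬝ᵥ (K *ᵥ h) := by
    have : h ⬝ᵥ (K *ᵥ A) - h ⬝ᵥ (K *ᵥ h) = 0 := by
      rw [← dotProduct_sub, ← Matrix.mulVec_sub]; exact c2
    exact sub_eq_zero.mp this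
  rw [e1, e2]; ring

/-! ## §2. The constrained propagator -/

/-- `Q G = 0`. [folklore] -/
theorem constraint_mul_constrProp (K : Matrix ν ν 𝕜) (Q : Matrix μ ν 𝕜) (hP : IsUnit (blockProp K Q).det) :
    Q * constrProp K Q = 0 := by
  have h : Q * (minMap K Q * Q * K⁻¹) = Q * minMap K Q * Q * K⁻¹ := by simp only [Matrix.mul_assoc]
  rw [constrProp, Matrix.mul_sub, h, constraint_mul_minMap K Q hP, Matrix.one_mul, sub_self]

/-- `G Qᵀ = 0`. [folklore] -/
theorem constrProp_mul_transpose (K : Matrix ν ν 𝕜) (Q : Matrix μ ν 𝕜) (hP : IsUnit (blockProp K Q).det) :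
    constrProp K Q * Qᵀ = 0 := by
  have h : minMap K Q * Q * K⁻¹ * Qᵀ = K⁻¹ * Qᵀ := by
    have h' : minMap K Q * Q * K⁻¹ * Qᵀ = K⁻¹ * Qᵀ * ((blockProp K Q)⁻¹ * blockProp K Q) := by
      simp only [minMap, blockProp_eq, Matrix.mul_assoc]
    rw [h', Matrix.nonsing_inv_mul _ hP, Matrix.mul_one]
  rw [constrProp, Matrix.sub_mul, h, sub_self]

/-- `K G = 1 − Qᵀ Hᴸ` (the complementary "projection"). [folklore] -/
theorem mul_constrProp (K : Matrix ν ν 𝕜) (Q : Matrix μ ν 𝕜) (hK : IsUnit K.det) :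
    K * constrProp K Q = 1 - Qᵀ * minMapL K Q := by
  rw [constrProp, Matrix.mul_sub, Matrix.mul_nonsing_inv K hK]
  congr 1
  simp only [minMap, minMapL, Matrix.mul_assoc]
  rw [Matrix.mul_nonsing_inv_cancel_left K _ hK]

/-! ## §3. Exact resolvent / envelope identities for two forms `K₀`, `K₁` with the same constraint map -/

/-- Resolvent identity `K₀⁻¹ − K₁⁻¹ = K₀⁻¹ (K₁ − K₀) K₁⁻¹`. [folklore] -/
theorem inv_sub_inv (K₀ K₁ : Matrix ν ν 𝕜) (hK₀ : IsUnit K₀.det) (hK₁ : IsUnit K₁.det) :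
    K₀⁻¹ - K₁⁻¹ = K₀⁻¹ * (K₁ - K₀) * K₁⁻¹ := by
  rw [Matrix.mul_sub, Matrix.sub_mul, Matrix.mul_nonsing_inv_cancel_right K₁ _ hK₁, Matrix.nonsing_inv_mul K₀ hK₀,
    Matrix.one_mul]

omit [Fintype μ] [DecidableEq μ] in
/-- The block propagators differ by `P₀ − P₁ = Q (K₀⁻¹ − K₁⁻¹) Qᵀ`. [folklore] -/
theorem blockProp_sub_blockProp (K₀ K₁ : Matrix ν ν 𝕜) (Q : Matrix μ ν 𝕜) :
    blockProp K₀ Q - blockProp K₁ Q = Q * (K₀⁻¹ - K₁⁻¹) * Qᵀ := by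
  simp only [blockProp_eq, Matrix.mul_sub, Matrix.sub_mul]

/-- FIRST ENVELOPE IDENTITY (exact): `P₁⁻¹ − P₀⁻¹ = H₀ᴸ (K₁ − K₀) H₁`.  To first order in `E = K₁ − K₀` the value forms
differ by `H₀ᴸ E H₀` — the variation of the form sandwiched between the UNVARIED minimisers (AN1.md Table T, row T4:
the background dependence of `H₁(U)` enters the one-step form only at second order). [folklore] -/
theorem value_sub_value (K₀ K₁ : Matrix ν ν 𝕜) (Q : Matrix μ ν 𝕜) (hK₀ : IsUnit K₀.det) (hK₁ : IsUnit K₁.det)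
    (hP₀ : IsUnit (blockProp K₀ Q).det) (hP₁ : IsUnit (blockProp K₁ Q).det) :
    (blockProp K₁ Q)⁻¹ - (blockProp K₀ Q)⁻¹ = minMapL K₀ Q * (K₁ - K₀) * minMap K₁ Q := by
  have h1 : minMapL K₀ Q * (K₁ - K₀) * minMap K₁ Q =
      (blockProp K₀ Q)⁻¹ * (Q * (K₀⁻¹ * (K₁ - K₀) * K₁⁻¹) * Qᵀ) * (blockProp K₁ Q)⁻¹ := by
    simp only [minMapL, minMap, Matrix.mul_assoc]
  rw [h1, ← inv_sub_inv K₀ K₁ hK₀ hK₁, ← blockProp_sub_blockProp K₀ K₁ Q, Matrix.mul_sub, Matrix.sub_mul,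
    Matrix.nonsing_inv_mul _ hP₀, Matrix.one_mul, Matrix.mul_nonsing_inv_cancel_right _ _ hP₁]

/-- MINIMISER RESPONSE (exact): `H₁ − H₀ = −G₀ (K₁ − K₀) H₁` — the first-order response of the minimiser map is
`−G₀ E H₀`, through the constrained propagator. [folklore] -/
theorem minMap_sub_minMap (K₀ K₁ : Matrix ν ν 𝕜) (Q : Matrix μ ν 𝕜) (hK₀ : IsUnit K₀.det) (hK₁ : IsUnit K₁.det)
    (hP₀ : IsUnit (blockProp K₀ Q).det) (hP₁ : IsUnit (blockProp K₁ Q).det) :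
    minMap K₁ Q - minMap K₀ Q = -(constrProp K₀ Q * (K₁ - K₀) * minMap K₁ Q) := by
  have hA : K₀⁻¹ * (K₁ - K₀) * minMap K₁ Q = K₀⁻¹ * Qᵀ * (blockProp K₁ Q)⁻¹ - minMap K₁ Q := by
    have h : K₀⁻¹ * (K₁ - K₀) * minMap K₁ Q = K₀⁻¹ * (K₁ - K₀) * K₁⁻¹ * Qᵀ * (blockProp K₁ Q)⁻¹ := by
      simp only [minMap, Matrix.mul_assoc]
    rw [h, ← inv_sub_inv K₀ K₁ hK₀ hK₁, Matrix.sub_mul, Matrix.sub_mul]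
    rfl
  have hB : minMap K₀ Q * Q * K₀⁻¹ * (K₁ - K₀) * minMap K₁ Q =
      K₀⁻¹ * Qᵀ * (blockProp K₁ Q)⁻¹ - minMap K₀ Q := by
    have h : minMap K₀ Q * Q * K₀⁻¹ * (K₁ - K₀) * minMap K₁ Q =
        minMap K₀ Q * (Q * (K₀⁻¹ * (K₁ - K₀) * K₁⁻¹) * Qᵀ) * (blockProp K₁ Q)⁻¹ := by
      simp only [minMap, Matrix.mul_assoc]
    rw [h, ← inv_sub_inv K₀ K₁ hK₀ hK₁, ← blockProp_sub_blockProp K₀ K₁ Q, Matrix.mul_sub, Matrix.sub_mul,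
      Matrix.mul_nonsing_inv_cancel_right _ _ hP₁]
    congr 1
    have h' : minMap K₀ Q * blockProp K₀ Q = K₀⁻¹ * Qᵀ := by
      rw [minMap, Matrix.nonsing_inv_mul_cancel_right _ _ hP₀]
    rw [h']
  rw [constrProp, Matrix.sub_mul, Matrix.sub_mul, hA, hB]
  abel

/-- SECOND ENVELOPE IDENTITY (exact): `P₁⁻¹ − P₀⁻¹ = H₀ᴸ E H₀ − H₀ᴸ E G₀ E H₁`, `E = K₁ − K₀` — frozen minimisers at
first order, and the second-order correction `−Hᵀ E G E H` through the constrained propagator. [folklore] -/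
theorem value_sub_value₂ (K₀ K₁ : Matrix ν ν 𝕜) (Q : Matrix μ ν 𝕜) (hK₀ : IsUnit K₀.det) (hK₁ : IsUnit K₁.det)
    (hP₀ : IsUnit (blockProp K₀ Q).det) (hP₁ : IsUnit (blockProp K₁ Q).det) :
    (blockProp K₁ Q)⁻¹ - (blockProp K₀ Q)⁻¹ =
      minMapL K₀ Q * (K₁ - K₀) * minMap K₀ Q
        - minMapL K₀ Q * (K₁ - K₀) * constrProp K₀ Q * (K₁ - K₀) * minMap K₁ Q := by
  have h' := minMap_sub_minMap K₀ K₁ Q hK₀ hK₁ hP₀ hP₁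
  have h : minMap K₁ Q = minMap K₀ Q - constrProp K₀ Q * (K₁ - K₀) * minMap K₁ Q :=
    calc minMap K₁ Q = (minMap K₁ Q - minMap K₀ Q) + minMap K₀ Q := (sub_add_cancel _ _).symm
      _ = -(constrProp K₀ Q * (K₁ - K₀) * minMap K₁ Q) + minMap K₀ Q := by rw [h']
      _ = minMap K₀ Q - constrProp K₀ Q * (K₁ - K₀) * minMap K₁ Q := by rw [neg_add_eq_sub]
  rw [value_sub_value K₀ K₁ Q hK₀ hK₁ hP₀ hP₁]
  conv_lhs => rw [h]
  generalize K₁ - K₀ = E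
  simp only [Matrix.mul_sub, Matrix.mul_assoc]

end Algebra

/-! ## §4. Real symmetric case: minimality, and non-vacuity of the hypotheses -/

section Real

variable {ν μ : Type*} [Fintype ν] [Fintype μ] [DecidableEq ν] [DecidableEq μ]

/-- MINIMALITY ([Balaban1985BackgroundPropagators] (3.109)–(3.111) «unique minimum», finite-dimensional skeleton): for
real symmetric positive semidefinite invertible `K`, `⟨H B, K (H B)⟩ ≤ ⟨A, K A⟩` for every `A` with `Q A = B`. [folklore] -/
theorem quad_minMap_le (K : Matrix ν ν ℝ) (Q : Matrix μ ν ℝ) (hKs : Kᵀ = K) (hKp : K.PosSemidef)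
    (hK : IsUnit K.det) (hP : IsUnit (blockProp K Q).det) (A : ν → ℝ) (B : μ → ℝ) (hA : Q *ᵥ A = B) :
    (minMap K Q *ᵥ B) ⬝ᵥ (K *ᵥ (minMap K Q *ᵥ B)) ≤ A ⬝ᵥ (K *ᵥ A) := by
  rw [quad_eq_quad_minMap_add K Q hKs hK hP A B hA]
  have h := hKp.dotProduct_mulVec_nonneg (A - minMap K Q *ᵥ B)
  simp only [star_trivial] at h
  linarith

/-- The hypotheses used above are satisfiable (one fine and one block coordinate, `K = Q = 1`). [folklore] -/
theorem hypotheses_nonvacuous :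
    ∃ (K : Matrix (Fin 1) (Fin 1) ℝ) (Q : Matrix (Fin 1) (Fin 1) ℝ),
      Kᵀ = K ∧ K.PosSemidef ∧ IsUnit K.det ∧ IsUnit (blockProp K Q).det := by
  refine ⟨1, 1, Matrix.transpose_one, Matrix.PosSemidef.one, by simp, ?_⟩
  rw [blockProp_eq]
  simp

end Real

/-! ## §5. The bordered (KKT) inverse (v1.1): `[[K, Qᵀ],[Q, 0]]⁻¹ = [[G, H],[Hᴸ, −P⁻¹]]` -/

section Bordered

open Literature.MathematicalPhysics.QuantumFieldTheory.Balaban1983to89.Beta.Composition (kkt)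

variable {𝕜 : Type*} [Field 𝕜]
variable {ν μ : Type*} [Fintype ν] [Fintype μ] [DecidableEq ν] [DecidableEq μ]

/-- Right inverse: `[[K, Qᵀ],[Q, 0]] · [[G, H],[Hᴸ, −P⁻¹]] = 1` for invertible `K` and `P = Q K⁻¹ Qᵀ` — the four block
identities are `K G + Qᵀ Hᴸ = 1` (`mul_constrProp`), `K H − Qᵀ P⁻¹ = 0` (`mul_minMap`), `Q G = 0`, `Q H = 1`. [folklore] -/
theorem kkt_mul_blocks (K : Matrix ν ν 𝕜) (Q : Matrix μ ν 𝕜) (hK : IsUnit K.det) (hP : IsUnit (blockProp K Q).det) :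
    kkt K Q * Matrix.fromBlocks (constrProp K Q) (minMap K Q) (minMapL K Q) (-(blockProp K Q)⁻¹) = 1 := by
  show Matrix.fromBlocks K Qᵀ Q 0 * _ = 1
  rw [Matrix.fromBlocks_multiply, mul_constrProp K Q hK, mul_minMap K Q hK, constraint_mul_constrProp K Q hP,
    constraint_mul_minMap K Q hP]
  simp only [sub_add_cancel, Matrix.mul_neg, add_neg_cancel, Matrix.zero_mul, add_zero, neg_zero, Matrix.fromBlocks_one]

/-- Left inverse: `[[G, H],[Hᴸ, −P⁻¹]] · [[K, Qᵀ],[Q, 0]] = 1`. [folklore] -/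
theorem blocks_mul_kkt (K : Matrix ν ν 𝕜) (Q : Matrix μ ν 𝕜) (hK : IsUnit K.det) (hP : IsUnit (blockProp K Q).det) :
    Matrix.fromBlocks (constrProp K Q) (minMap K Q) (minMapL K Q) (-(blockProp K Q)⁻¹) * kkt K Q = 1 :=
  mul_eq_one_comm.mp (kkt_mul_blocks K Q hK hP)

/-- THE BORDERED INVERSE: `[[K, Qᵀ],[Q, 0]]⁻¹ = [[G, H],[Hᴸ, −P⁻¹]]` — the `Γ, Ξ, Ξᵀ, Σ` blocks of AN1.md (MF′) are the
constrained propagator `G`, the minimiser map `H` ([Balaban1985BackgroundPropagators] (3.129) pattern), its left companion,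
and MINUS the inverse block propagator `−(Q K⁻¹ Qᵀ)⁻¹` (= minus the next effective form of `Beta.Composition`). [folklore] -/
theorem kkt_inv (K : Matrix ν ν 𝕜) (Q : Matrix μ ν 𝕜) (hK : IsUnit K.det) (hP : IsUnit (blockProp K Q).det) :
    (kkt K Q)⁻¹ = Matrix.fromBlocks (constrProp K Q) (minMap K Q) (minMapL K Q) (-(blockProp K Q)⁻¹) :=
  Matrix.inv_eq_right_inv (kkt_mul_blocks K Q hK hP)

end Bordered

/-! ## §6. Trace / projection identities (v1.2): `K G` is a projection of rank `card ν − card μ` -/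

section Trace

variable {𝕜 : Type*} [Field 𝕜]
variable {ν μ : Type*} [Fintype ν] [Fintype μ] [DecidableEq ν] [DecidableEq μ]

/-- `G K G = G`: the constrained propagator is a generalised inverse of `K` (from `K G = 1 − Qᵀ Hᴸ` and `G Qᵀ = 0`).
[folklore] -/
theorem constrProp_mul_mul_constrProp (K : Matrix ν ν 𝕜) (Q : Matrix μ ν 𝕜) (hK : IsUnit K.det)
    (hP : IsUnit (blockProp K Q).det) :
    constrProp K Q * K * constrProp K Q = constrProp K Q := by
  rw [Matrix.mul_assoc, mul_constrProp K Q hK, Matrix.mul_sub, Matrix.mul_one, ← Matrix.mul_assoc,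
    constrProp_mul_transpose K Q hP, Matrix.zero_mul, sub_zero]

/-- `(K G)² = K G`: `K G` is idempotent (the projection onto the `K`-orthogonal complement of `range Qᵀ`… acting on
fluctuations). [folklore] -/
theorem mul_constrProp_idem (K : Matrix ν ν 𝕜) (Q : Matrix μ ν 𝕜) (hK : IsUnit K.det)
    (hP : IsUnit (blockProp K Q).det) :
    K * constrProp K Q * (K * constrProp K Q) = K * constrProp K Q := by
  rw [Matrix.mul_assoc, ← Matrix.mul_assoc (constrProp K Q), constrProp_mul_mul_constrProp K Q hK hP]

/-- `Hᴸ Qᵀ = 1` in trace form: `trace (Qᵀ Hᴸ) = card μ`. [folklore] -/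
theorem trace_transpose_mul_minMapL (K : Matrix ν ν 𝕜) (Q : Matrix μ ν 𝕜) (hP : IsUnit (blockProp K Q).det) :
    Matrix.trace (Qᵀ * minMapL K Q) = Fintype.card μ := by
  rw [Matrix.trace_mul_comm, minMapL_mul_transpose K Q hP, Matrix.trace_one]

/-- THE RANK IDENTITY: `trace (K G) = card ν − card μ` — the number of fluctuation degrees of freedom (dimension of
`ker Q`).  Finite-dimensional skeleton of the exact identity «Σ_p c_p = Tr(Γ · Hess) = rank» of the cell's U(1) numerics.
[folklore] -/
theorem trace_mul_constrProp (K : Matrix ν ν 𝕜) (Q : Matrix μ ν 𝕜) (hK : IsUnit K.det)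
    (hP : IsUnit (blockProp K Q).det) :
    Matrix.trace (K * constrProp K Q) = (Fintype.card ν : 𝕜) - Fintype.card μ := by
  rw [mul_constrProp K Q hK, Matrix.trace_sub, Matrix.trace_one, trace_transpose_mul_minMapL K Q hP]

/-- The same number read on the other side: `trace (G K) = card ν − card μ`. [folklore] -/
theorem trace_constrProp_mul (K : Matrix ν ν 𝕜) (Q : Matrix μ ν 𝕜) (hK : IsUnit K.det)
    (hP : IsUnit (blockProp K Q).det) :
    Matrix.trace (constrProp K Q * K) = (Fintype.card ν : 𝕜) - Fintype.card μ := by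
  rw [Matrix.trace_mul_comm, trace_mul_constrProp K Q hK hP]

end Trace

end Literature.MathematicalPhysics.QuantumFieldTheory.Balaban1983to89.Beta.Envelope
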